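import Literature.Probability.LatticeModels.CoarseCellMixingDLR
import HarnessLib

/-!
# The chain rule of the Dobrushin–Shlosman block recursion WITH RARE BAD CELLS (typical-class currency)

Helper module for item `stmt-QuantumFields-19354` (crux `IR` of route `BalabanLadder`, sub-problem `YangMills`; lane B
«strong coupling after blocking»; `--supports`, it closes nothing).

`FiniteSizeCriterion.multiCell_influence_general` (`Theorems/OneCertifiedCubeFiniteSizeCriterionChainRule.lean`) is the
coupling-free chain rule "single-cell boundary influence `≤ δ` for every cell-union volume ⇒ influence `≤ |Y|·δ` on
`[0,1]`-valued observables of the cells `Y`", for exteriors agreeing near every cell of `Y`.  The TYPICAL-CLASS formats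
of crux `IR` (`OnsetFormatsUc.TypShellCondUKPc`: clause (i) = mixing only for exteriors in a cell-local class `Typ`,
clause (ii) = UKP rarity of atypical cells under the kernels) supply the single-cell bound only for exteriors that are
TYPICAL on the cells near the centre, and typicality of the resampled cells only with probability `≥ 1 − δ₂`.  This file
re-proves the chain rule in that currency:

* `multiCell_influence_typical` — cells are the fibres of `cell : V → C`; `near x v` (agreement) and `tnear x c`
  (typicality) are arbitrary relations, `adj y c` (the cells whose typicality clause (ii) asks for) with `adj ⊆ tnear`;
  `Good c` a measurable event read off the cell `c`.  IF (hR) for every cell-union `Λ`, cell `x`, exteriors agreeing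
  near `x` off `Λ` AND good on every cell having a site off `Λ` which is `tnear x`, the `γ_Λ`-expectations of every
  `[0,1]`-valued observable of the cell `x` are within `δ₁`, and (hRare) for every cell-union `Λ`, every cell `y ⊆ Λ`
  and every exterior good on the off-`Λ` cells `adj y`, `γ_Λ(ζ){σ ∉ Good y} ≤ δ₂`, THEN an observable of the cells `Y`
  has influence `≤ |Y|·(δ₁ + δ₂)` for exteriors agreeing near and good `tnear` every cell of `Y`.
  Proof = the tree's induction on `Y` (condition on one cell `y`, freeze it inside the inner kernel, compare the hybrid)
  with ONE new term: the frozen cell `y` must itself be good for the induction hypothesis to apply to the smaller volume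
  `Λ ∖ y` — it is, off an event of `γ_Λ(ζ)`-mass `≤ δ₂` (hRare), on which the two inner expectations still differ by
  at most `1`.
* `multiCell_influence_typical_of_abs_le` — the affine-rescaling corollary (sup norm `≤ λ`, factor `2λ`).

HONEST FRAMING: an abstract probability lemma about specifications (Georgii); no statement about Yang–Mills mixing,
no gap, not Clay.  No `sorry`; axioms ⊆ {propext, Classical.choice, Quot.sound}.

## References

* R. L. Dobrushin, S. B. Shlosman, *Constructive criterion for the uniqueness of Gibbs field* (1985), §2.
* L. Bertini, E. N. M. Cirillo, E. Olivieri, *Renormalization group in the uniqueness region: weak Gibbsianity and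
  convergence*, Commun. Math. Phys. 261 (2006) — graded expansions with sparse bad blocks (the in-print sibling of the
  typical-class bookkeeping).
* H.-O. Georgii, *Gibbs Measures and Phase Transitions* (2011), §8.2.
-/

noncomputable section

open MeasureTheory
open Literature.Probability.LatticeModels

namespace Summit.QuantumFields.YangMills.Theorems.FiniteSizeCriterion

variable {V S C : Type*} [MeasurableSpace S]

/-- **Multi-cell influence from single-cell influence, typical-class currency** (chain rule of the block recursion
with rare bad cells).  See the module docstring for the hypotheses `hR` (single-cell bound `δ₁` for exteriors agreeing
near the centre and good on the off-volume cells `tnear` it) and `hRare` (a resampled cell is bad with `γ_Λ`-probability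
`≤ δ₂` once the off-volume cells `adj` to it are good).  Conclusion: `|∫ H dγ_Λ(ζ) − ∫ H dγ_Λ(ζ')| ≤ |Y|·(δ₁ + δ₂)` for a
`[0,1]`-valued measurable observable `H` of the cells `Y`, whenever `ζ, ζ'` agree near every cell of `Y` off `Λ` and are
good on every cell with a site off `Λ` which is `tnear` some cell of `Y`. -/
theorem multiCell_influence_typical [DecidableEq C] {cell : V → C} {near : C → V → Prop}
    (hnear : ∀ v, near (cell v) v) {tnear adj : C → C → Prop} (hadj : ∀ y c, adj y c → tnear y c)
    {Good : C → Set (V → S)} (hGoodm : ∀ c, MeasurableSet (Good c))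
    (hGooddep : ∀ c, DependsOn (fun σ : V → S => σ ∈ Good c) {v | cell v = c})
    {γ : Specification V S} (hγ : IsSpecification γ) {δ₁ δ₂ : ℝ} (hδ₂ : 0 ≤ δ₂)
    (hR : ∀ (Λ : Finset V), (∀ v w, cell v = cell w → v ∈ Λ → w ∈ Λ) →
      ∀ (x : C) (g : (V → S) → ℝ), Measurable g → (∀ σ, 0 ≤ g σ ∧ g σ ≤ 1) →
      DependsOn g {v | cell v = x} →
      ∀ ζ ζ' : V → S, (∀ v, v ∉ Λ → near x v → ζ v = ζ' v) →
        (∀ c, tnear x c → ∀ v, cell v = c → v ∉ Λ → ζ ∈ Good c ∧ ζ' ∈ Good c) →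
        |∫ σ, g σ ∂(γ Λ ζ) - ∫ σ, g σ ∂(γ Λ ζ')| ≤ δ₁)
    (hRare : ∀ (Λ : Finset V), (∀ v w, cell v = cell w → v ∈ Λ → w ∈ Λ) →
      ∀ (y : C), (∃ v ∈ Λ, cell v = y) →
      ∀ ζ : V → S, (∀ c, adj y c → ∀ v, cell v = c → v ∉ Λ → ζ ∈ Good c) →
        (γ Λ ζ).real {σ | σ ∉ Good y} ≤ δ₂)
    (Y : Finset C) :
    ∀ (Λ : Finset V), (∀ v w, cell v = cell w → v ∈ Λ → w ∈ Λ) →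
      ∀ (H : (V → S) → ℝ), Measurable H → (∀ σ, 0 ≤ H σ ∧ H σ ≤ 1) →
      DependsOn H {v | cell v ∈ Y} →
      ∀ ζ ζ' : V → S, (∀ y ∈ Y, ∀ v, v ∉ Λ → near y v → ζ v = ζ' v) →
        (∀ y ∈ Y, ∀ c, tnear y c → ∀ v, cell v = c → v ∉ Λ → ζ ∈ Good c ∧ ζ' ∈ Good c) →
        |∫ σ, H σ ∂(γ Λ ζ) - ∫ σ, H σ ∂(γ Λ ζ')| ≤ Y.card * (δ₁ + δ₂) := by
  classical
  refine Finset.induction_on Y ?_ ?_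
  · intro Λ _ H _ _ hHdep ζ ζ' _ _
    have hconst : ∀ σ τ, H σ = H τ := fun σ τ =>
      hHdep fun v hv => absurd hv (Finset.notMem_empty _)
    haveI := hγ.isProbability Λ ζ
    haveI := hγ.isProbability Λ ζ'
    have hH : H = fun _ => H ζ := funext fun σ => hconst σ ζ
    rw [hH]
    simp
  · intro y Y' hy IH Λ hΛ H hHm hH01 hHdep ζ ζ' hagree hgood
    -- remove the cell `y` from the volume
    set Λ₁ : Finset V := Λ.filter fun v => cell v ≠ y with hΛ₁
    have hΛ₁Λ : Λ₁ ⊆ Λ := Finset.filter_subset _ _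
    have hΛ₁union : ∀ v w, cell v = cell w → v ∈ Λ₁ → w ∈ Λ₁ := fun v w hvw hv => by
      rw [hΛ₁, Finset.mem_filter] at hv ⊢
      exact ⟨hΛ v w hvw hv.1, hvw ▸ hv.2⟩
    have hH1 : ∀ σ, |H σ| ≤ 1 := fun σ => by rw [abs_of_nonneg (hH01 σ).1]; exact (hH01 σ).2
    have hcons : ∀ η, ∫ σ, H σ ∂(γ Λ η) = ∫ σ, (∫ τ, H τ ∂(γ Λ₁ σ)) ∂(γ Λ η) := fun η =>
      (kernel_integral_integral_eq_of_subset hγ hΛ₁Λ η hHm hH1).symm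
    -- the hybrid glue: `σ` on `Λ`, `ζ'` off `Λ`
    let J : (V → S) → (V → S) := fun σ v => if v ∈ Λ then σ v else ζ' v
    have hJm : Measurable J := by
      refine measurable_pi_iff.2 fun v => ?_
      by_cases hv : v ∈ Λ
      · simp only [J, hv, if_true]
        exact measurable_pi_apply v
      · simp only [J, hv, if_false]
        exact measurable_const
    set G : (V → S) → ℝ := fun σ => ∫ τ, H τ ∂(γ Λ₁ (J σ)) with hG
    have hGm : Measurable G := (DobrushinShlosman.measurable_windowAvg' hγ Λ₁ hHm).comp hJm
    have hG01 : ∀ σ, 0 ≤ G σ ∧ G σ ≤ 1 := fun σ => by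
      haveI := hγ.isProbability Λ₁ (J σ)
      exact integral_mem_unitInterval hHm hH01
    have hG1 : ∀ σ, |G σ| ≤ 1 := fun σ => by rw [abs_of_nonneg (hG01 σ).1]; exact (hG01 σ).2
    have hGdep : DependsOn G {v | cell v = y} := by
      intro σ σ' hσσ'
      simp only [hG]
      rw [DobrushinShlosman.spec_apply_congr hγ Λ₁ (ω := J σ) (η := J σ') ?_]
      intro v hv
      by_cases hvΛ : v ∈ Λ
      · have hvy : cell v = y := by
          by_contra h
          exact hv (Finset.mem_filter.2 ⟨hvΛ, h⟩)
        simp only [J, hvΛ, if_true]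
        exact hσσ' v hvy
      · simp only [J, hvΛ, if_false]
    -- (ii) the hybrid is a single-cell observable of `y`
    have hii : |∫ σ, G σ ∂(γ Λ ζ) - ∫ σ, G σ ∂(γ Λ ζ')| ≤ δ₁ :=
      hR Λ hΛ y G hGm hG01 hGdep ζ ζ' (fun v hv hd => hagree y (Finset.mem_insert_self y Y') v hv hd)
        fun c hc v hvc hv => hgood y (Finset.mem_insert_self y Y') c hc v hvc hv
    -- under `ζ'` the hybrid is the honest inner kernel
    have hG' : ∫ σ, G σ ∂(γ Λ ζ') = ∫ σ, (∫ τ, H τ ∂(γ Λ₁ σ)) ∂(γ Λ ζ') := by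
      refine integral_congr_ae ?_
      filter_upwards [hγ.proper Λ ζ'] with σ hσ
      simp only [hG]
      have hJσ : J σ = σ := funext fun v => by
        by_cases hv : v ∈ Λ
        · simp only [J, hv, if_true]
        · simp only [J, hv, if_false]
          exact (hσ v hv).symm
      rw [hJσ]
    -- the good event for the frozen cell `y`
    set E : Set (V → S) := {σ | (∃ v ∈ Λ, cell v = y) → σ ∈ Good y} with hE
    have hEm : MeasurableSet E := by
      by_cases hyΛ : ∃ v ∈ Λ, cell v = y
      · have : E = Good y := Set.ext fun σ => ⟨fun h => h hyΛ, fun h _ => h⟩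
        rw [this]; exact hGoodm y
      · have : E = Set.univ := Set.eq_univ_of_forall fun σ h => absurd h hyΛ
        rw [this]; exact MeasurableSet.univ
    have hEc : (γ Λ ζ).real Eᶜ ≤ δ₂ := by
      by_cases hyΛ : ∃ v ∈ Λ, cell v = y
      · have : Eᶜ = {σ | σ ∉ Good y} := Set.ext fun σ =>
          ⟨fun h hg => h fun _ => hg, fun h hE => h (hE hyΛ)⟩
        rw [this]
        exact hRare Λ hΛ y hyΛ ζ fun c hc v hvc hv =>
          (hgood y (Finset.mem_insert_self y Y') c (hadj y c hc) v hvc hv).1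
      · have : Eᶜ = ∅ := Set.eq_empty_of_forall_notMem fun σ h => h fun h' => absurd h' hyΛ
        rw [this, measureReal_empty]
        exact hδ₂
    -- (i) under `ζ`, on the good event, the hybrid differs from the honest inner kernel by the induction hypothesis
    have hi : ∀ᵐ σ ∂(γ Λ ζ), |(∫ τ, H τ ∂(γ Λ₁ σ)) - G σ| ≤ Y'.card * (δ₁ + δ₂) + Eᶜ.indicator (fun _ => (1 : ℝ)) σ := by
      filter_upwards [hγ.proper Λ ζ] with σ hσ
      by_cases hσE : σ ∈ E
      swap
      · have h1 : |(∫ τ, H τ ∂(γ Λ₁ σ)) - G σ| ≤ 1 := by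
          haveI := hγ.isProbability Λ₁ σ
          have ha := integral_mem_unitInterval (μ := γ Λ₁ σ) hHm hH01
          have hb := hG01 σ
          rw [abs_le]; constructor <;> linarith [ha.1, ha.2, hb.1, hb.2]
        have hind : Eᶜ.indicator (fun _ => (1 : ℝ)) σ = 1 := Set.indicator_of_mem (Set.mem_compl hσE) _
        rw [hind]
        have h0 : 0 ≤ (Y'.card : ℝ) * (δ₁ + δ₂) := by
          have hδ₁ : 0 ≤ δ₁ := (abs_nonneg _).trans hii
          positivity
        linarith
      -- the good branch: freeze the cell `y` at `σ`
      have hind : Eᶜ.indicator (fun _ => (1 : ℝ)) σ = 0 :=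
        Set.indicator_of_notMem (fun h => Set.notMem_of_mem_compl h hσE) _
      rw [hind, add_zero]
      let Hs : (V → S) → ℝ := fun ω => H (fun v => if cell v = y then σ v else ω v)
      have hfrz : Measurable fun ω : V → S => (fun v => if cell v = y then σ v else ω v) := by
        refine measurable_pi_iff.2 fun v => ?_
        by_cases h : cell v = y
        · simp only [h, if_true]
          exact measurable_const
        · simp only [h, if_false]
          exact measurable_pi_apply v
      have hHsm : Measurable Hs := hHm.comp hfrz
      have hHs01 : ∀ ω, 0 ≤ Hs ω ∧ Hs ω ≤ 1 := fun ω => hH01 _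
      have hHsdep : DependsOn Hs {v | cell v ∈ Y'} := by
        intro ω ω' hωω'
        simp only [Hs]
        apply hHdep
        intro v hv
        by_cases hvy : cell v = y
        · simp only [hvy, if_true]
        · simp only [hvy, if_false]
          have hv' : cell v ∈ insert y Y' := hv
          rcases Finset.mem_insert.1 hv' with h | h
          · exact absurd h hvy
          · exact hωω' v h
      have hfreeze : ∀ η : V → S, (∀ v, cell v = y → η v = σ v) →
          ∫ τ, H τ ∂(γ Λ₁ η) = ∫ τ, Hs τ ∂(γ Λ₁ η) := by
        intro η hη
        refine integral_congr_ae ?_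
        filter_upwards [hγ.proper Λ₁ η] with τ hτ
        simp only [Hs]
        congr 1
        funext v
        by_cases hvy : cell v = y
        · simp only [hvy, if_true]
          have hvΛ₁ : v ∉ Λ₁ := fun h => (Finset.mem_filter.1 h).2 hvy
          rw [hτ v hvΛ₁, hη v hvy]
        · simp only [hvy, if_false]
      have e1 : ∫ τ, H τ ∂(γ Λ₁ σ) = ∫ τ, Hs τ ∂(γ Λ₁ σ) := hfreeze σ fun v _ => rfl
      have e2 : G σ = ∫ τ, Hs τ ∂(γ Λ₁ (J σ)) := by
        simp only [hG]
        refine hfreeze (J σ) fun v hvy => ?_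
        by_cases hvΛ : v ∈ Λ
        · simp only [J, hvΛ, if_true]
        · simp only [J, hvΛ, if_false]
          rw [hσ v hvΛ]
          exact (hagree y (Finset.mem_insert_self _ _) v hvΛ (hvy ▸ hnear v)).symm
      rw [e1, e2]
      refine IH Λ₁ hΛ₁union Hs hHsm hHs01 hHsdep σ (J σ) (fun y' hy' v hv hd => ?_) fun y' hy' c hc v hvc hv => ?_
      · by_cases hvΛ : v ∈ Λ
        · simp only [J, hvΛ, if_true]
        · simp only [J, hvΛ, if_false]
          rw [hσ v hvΛ]
          exact hagree y' (Finset.mem_insert_of_mem hy') v hvΛ hd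
      · by_cases hvΛ : v ∈ Λ
        · -- a site of `Λ ∖ Λ₁`: its cell is `y`, all of whose sites lie in `Λ`; `J σ = σ` there and `σ` is good
          have hvy : cell v = y := by
            by_contra h
            exact hv (Finset.mem_filter.2 ⟨hvΛ, h⟩)
          have hcy : c = y := hvc.symm.trans hvy
          rw [hcy]
          have hσg : σ ∈ Good y := hσE ⟨v, hvΛ, hvy⟩
          have e : (J σ ∈ Good y) = (σ ∈ Good y) :=
            hGooddep y fun u (hu : cell u = y) => by
              have huΛ : u ∈ Λ := hΛ v u (hvy.trans hu.symm) hvΛ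
              simp only [J, huΛ, if_true]
          exact ⟨hσg, e.mpr hσg⟩
        · have hc' := hgood y' (Finset.mem_insert_of_mem hy') c hc v hvc hvΛ
          have hcells : ∀ u, cell u = c → u ∉ Λ := fun u hu huΛ => hvΛ (hΛ u v (hu.trans hvc.symm) huΛ)
          have e : (σ ∈ Good c) = (ζ ∈ Good c) := hGooddep c fun u (hu : cell u = c) => hσ u (hcells u hu)
          have e' : (J σ ∈ Good c) = (ζ' ∈ Good c) := hGooddep c fun u (hu : cell u = c) => by
            simp only [J, hcells u hu, if_false]
          exact ⟨e.mpr hc'.1, e'.mpr hc'.2⟩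
    -- assemble
    haveI := hγ.isProbability Λ ζ
    haveI := hγ.isProbability Λ ζ'
    have hKi : Integrable (fun σ => ∫ τ, H τ ∂(γ Λ₁ σ)) (γ Λ ζ) :=
      DobrushinMetric.integrable_of_abs_le' (DobrushinShlosman.measurable_windowAvg' hγ Λ₁ hHm)
        (DobrushinShlosman.abs_windowAvg_le' hγ Λ₁ hH1)
    have hGi : Integrable G (γ Λ ζ) := DobrushinMetric.integrable_of_abs_le' hGm hG1
    have hIi : Integrable (fun σ => Eᶜ.indicator (fun _ => (1 : ℝ)) σ) (γ Λ ζ) :=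
      (integrable_const (1 : ℝ)).indicator hEm.compl
    have hBi : Integrable (fun σ => (Y'.card : ℝ) * (δ₁ + δ₂) + Eᶜ.indicator (fun _ => (1 : ℝ)) σ) (γ Λ ζ) :=
      (integrable_const _).add hIi
    have hdiff : |∫ σ, (∫ τ, H τ ∂(γ Λ₁ σ)) ∂(γ Λ ζ) - ∫ σ, G σ ∂(γ Λ ζ)| ≤ Y'.card * (δ₁ + δ₂) + δ₂ := by
      rw [← integral_sub hKi hGi]
      calc |∫ σ, ((∫ τ, H τ ∂(γ Λ₁ σ)) - G σ) ∂(γ Λ ζ)|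
          ≤ ∫ σ, |(∫ τ, H τ ∂(γ Λ₁ σ)) - G σ| ∂(γ Λ ζ) := by
            rw [← Real.norm_eq_abs]; exact norm_integral_le_integral_norm _
        _ ≤ ∫ σ, ((Y'.card : ℝ) * (δ₁ + δ₂) + Eᶜ.indicator (fun _ => (1 : ℝ)) σ) ∂(γ Λ ζ) :=
            integral_mono_ae (hKi.sub hGi).abs hBi hi
        _ = Y'.card * (δ₁ + δ₂) + (γ Λ ζ).real Eᶜ := by
            rw [integral_add (integrable_const _) hIi, integral_const, integral_indicator_const _ hEm.compl]
            simp
        _ ≤ Y'.card * (δ₁ + δ₂) + δ₂ := by gcongr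
    calc |∫ σ, H σ ∂(γ Λ ζ) - ∫ σ, H σ ∂(γ Λ ζ')|
        = |∫ σ, (∫ τ, H τ ∂(γ Λ₁ σ)) ∂(γ Λ ζ) - ∫ σ, G σ ∂(γ Λ ζ')| := by
          rw [hcons ζ, hcons ζ', hG']
      _ ≤ |∫ σ, (∫ τ, H τ ∂(γ Λ₁ σ)) ∂(γ Λ ζ) - ∫ σ, G σ ∂(γ Λ ζ)| +
            |∫ σ, G σ ∂(γ Λ ζ) - ∫ σ, G σ ∂(γ Λ ζ')| := abs_sub_le _ _ _
      _ ≤ (Y'.card * (δ₁ + δ₂) + δ₂) + δ₁ := add_le_add hdiff hii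
      _ = (insert y Y').card * (δ₁ + δ₂) := by
          rw [Finset.card_insert_of_notMem hy]
          push_cast
          ring

/-- **Chain rule for bounded observables, typical-class currency**: under the hypotheses of
`multiCell_influence_typical`, an observable of the cells `Y` with sup norm `≤ λ` has influence `≤ 2λ·|Y|·(δ₁ + δ₂)`
(rescale `(H/λ + 1)/2 ∈ [0,1]`; same proof as `multiCell_influence_general_of_abs_le`). -/
theorem multiCell_influence_typical_of_abs_le [DecidableEq C] {cell : V → C} {near : C → V → Prop}
    (hnear : ∀ v, near (cell v) v) {tnear adj : C → C → Prop} (hadj : ∀ y c, adj y c → tnear y c)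
    {Good : C → Set (V → S)} (hGoodm : ∀ c, MeasurableSet (Good c))
    (hGooddep : ∀ c, DependsOn (fun σ : V → S => σ ∈ Good c) {v | cell v = c})
    {γ : Specification V S} (hγ : IsSpecification γ) {δ₁ δ₂ : ℝ} (hδ₁ : 0 ≤ δ₁) (hδ₂ : 0 ≤ δ₂)
    (hR : ∀ (Λ : Finset V), (∀ v w, cell v = cell w → v ∈ Λ → w ∈ Λ) →
      ∀ (x : C) (g : (V → S) → ℝ), Measurable g → (∀ σ, 0 ≤ g σ ∧ g σ ≤ 1) →
      DependsOn g {v | cell v = x} →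
      ∀ ζ ζ' : V → S, (∀ v, v ∉ Λ → near x v → ζ v = ζ' v) →
        (∀ c, tnear x c → ∀ v, cell v = c → v ∉ Λ → ζ ∈ Good c ∧ ζ' ∈ Good c) →
        |∫ σ, g σ ∂(γ Λ ζ) - ∫ σ, g σ ∂(γ Λ ζ')| ≤ δ₁)
    (hRare : ∀ (Λ : Finset V), (∀ v w, cell v = cell w → v ∈ Λ → w ∈ Λ) →
      ∀ (y : C), (∃ v ∈ Λ, cell v = y) →
      ∀ ζ : V → S, (∀ c, adj y c → ∀ v, cell v = c → v ∉ Λ → ζ ∈ Good c) →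
        (γ Λ ζ).real {σ | σ ∉ Good y} ≤ δ₂)
    (Y : Finset C) (Λ : Finset V) (hΛ : ∀ v w, cell v = cell w → v ∈ Λ → w ∈ Λ)
    (H : (V → S) → ℝ) (hHm : Measurable H) {lam : ℝ} (hHb : ∀ σ, |H σ| ≤ lam)
    (hHdep : DependsOn H {v | cell v ∈ Y}) (ζ ζ' : V → S)
    (hagree : ∀ y ∈ Y, ∀ v, v ∉ Λ → near y v → ζ v = ζ' v)
    (hgood : ∀ y ∈ Y, ∀ c, tnear y c → ∀ v, cell v = c → v ∉ Λ → ζ ∈ Good c ∧ ζ' ∈ Good c) :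
    |∫ σ, H σ ∂(γ Λ ζ) - ∫ σ, H σ ∂(γ Λ ζ')| ≤ 2 * lam * (Y.card * (δ₁ + δ₂)) := by
  haveI := hγ.isProbability Λ ζ
  haveI := hγ.isProbability Λ ζ'
  have hlam : 0 ≤ lam := (abs_nonneg _).trans (hHb ζ)
  rcases hlam.eq_or_lt with hlam0 | hlampos
  · have hH0 : ∀ σ, H σ = 0 := fun σ => abs_nonpos_iff.1 (hlam0 ▸ hHb σ)
    have hδ : 0 ≤ (Y.card : ℝ) * (δ₁ + δ₂) := by positivity
    simp only [hH0, integral_zero, sub_self, abs_zero]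
    rw [← hlam0]
    simp
  · set Ht : (V → S) → ℝ := fun σ => (H σ / lam + 1) / 2 with hHt
    have hHtm : Measurable Ht := ((hHm.div_const lam).add_const 1).div_const 2
    have hHt01 : ∀ σ, 0 ≤ Ht σ ∧ Ht σ ≤ 1 := fun σ => by
      have h := hHb σ
      rw [abs_le] at h
      have hlo : -1 ≤ H σ / lam := by rw [le_div_iff₀ hlampos]; linarith [h.1]
      have hhi : H σ / lam ≤ 1 := by rw [div_le_iff₀ hlampos]; linarith [h.2]
      simp only [hHt]
      constructor <;> linarith
    have hHtdep : DependsOn Ht {v | cell v ∈ Y} := fun σ τ hστ => by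
      simp only [hHt, hHdep hστ]
    have hM := multiCell_influence_typical hnear hadj hGoodm hGooddep hγ hδ₂ hR hRare Y Λ hΛ Ht hHtm hHt01 hHtdep
      ζ ζ' hagree hgood
    have hlin : ∀ η : V → S, ∫ σ, H σ ∂(γ Λ η) = lam * (2 * ∫ σ, Ht σ ∂(γ Λ η) - 1) := by
      intro η
      haveI := hγ.isProbability Λ η
      have hHti : Integrable Ht (γ Λ η) := DobrushinMetric.integrable_of_abs_le' hHtm (M := 1)
        fun σ => by rw [abs_of_nonneg (hHt01 σ).1]; exact (hHt01 σ).2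
      have hH : H = fun σ => lam * (2 * Ht σ - 1) := funext fun σ => by
        simp only [hHt]; field_simp; ring
      conv_lhs => rw [hH]
      rw [integral_const_mul, integral_sub (hHti.const_mul 2) (integrable_const 1),
        integral_const_mul, integral_const]
      simp
    rw [hlin ζ, hlin ζ', ← mul_sub, abs_mul, abs_of_pos hlampos]
    have e : (2 * ∫ σ, Ht σ ∂(γ Λ ζ) - 1) - (2 * ∫ σ, Ht σ ∂(γ Λ ζ') - 1) =
        2 * (∫ σ, Ht σ ∂(γ Λ ζ) - ∫ σ, Ht σ ∂(γ Λ ζ')) := by ring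
    rw [e, abs_mul, abs_of_pos two_pos]
    calc lam * (2 * |∫ σ, Ht σ ∂(γ Λ ζ) - ∫ σ, Ht σ ∂(γ Λ ζ')|) ≤ lam * (2 * (Y.card * (δ₁ + δ₂))) := by
          gcongr
      _ = 2 * lam * (Y.card * (δ₁ + δ₂)) := by ring

end Summit.QuantumFields.YangMills.Theorems.FiniteSizeCriterion

end
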